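import Summits.AtomisticToContinuum.Crystallization.Theorems.PalmUnimodularRigidityLayeredLawsSelectHcpDefs
import Summits.AtomisticToContinuum.Crystallization.Theorems.ReggeStarCoercivityDefectFreeCrystallizesTwelveNeighbours
import Summits.AtomisticToContinuum.Crystallization.Theorems.ReggeStarCoercivityDefectFreeCrystallizesPalmDefs
import Literature.Probability.Process.PointStationaryLaw
import Literature.Geometry.DiscreteGeometry.KissingPatterns
import HarnessLib

/-!
# Small fcc-star defect forces a `1 %`-good root shell (stub G_fcc `stub_goodOfSmallFccDefect` of
# line `palm-good-law`, crux `ReggeStarCoercivity.DefectFreeCrystallizes`, stmt-AtomisticToContinuum-13603)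

**Theorem** (`stub_goodOfSmallFccDefect`).  Let `a₀ ∈ [189/200, 199/200]`, let `S ⊆ ℝ³` contain the
root `0`, let the root be `SetGood`, let the annulus `11/10 < ‖y‖ ≤ 5/4` carry no atom of `count|S`, and
let the fcc-star defect of the root star `rootStar (count|S) = {y : count|S {y} ≠ 0, 0 < ‖y‖ ≤ 11/10}`
against the regular cuboctahedron `a₀ • fccKissingPattern` be `< 1/20000`:
`⨅_A ∑_{p ∈ fccKissingPattern} infDist (A (a₀ • p)) (rootStar (count|S))² < 1/20000` (`A` over the
linear isometries of `ℝ³`).  Then at the scale `a = a₀ ∈ [9/10, 1]` the closed punctured `5a/4`-shell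
of the root, `{y : count|S {y} ≠ 0, y ≠ 0, ‖y‖ ≤ 5a/4}`, is a finite set `T` which is
`ShellCloseTo (a/100) T (a • fccKissingPattern)`.

**Proof.**  (1) An atom of `S` in the annulus would give the annulus positive counting mass, so every
atom `y ≠ 0` of `S` with `‖y‖ ≤ 5/4` has `‖y‖ ≤ 11/10`.  (2) By `stub_twelveNeighbours` the punctured
open ball `{0 < ‖y‖ < 6/5}` meets `S` in a finite set `T` of twelve points; by (1),
`T = rootStar (count|S) = {y : count|S {y} ≠ 0, y ≠ 0, ‖y‖ ≤ 5a₀/4}` (`11/10 ≤ 5a₀/4 ≤ 5/4`).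
(3) `exists_lt_of_ciInf_lt` gives an isometry `A` with `∑_p infDist(A(a₀ p), T)² < 1/20000`, so each
term is `< 1/20000 < (a₀/100)²`, and (`T ≠ ∅`, `Metric.infDist_lt_iff`) every pattern image
`A (a₀ • p)` has an atom of `T` within `a₀/100`.  (4) Two distinct pattern images are `≥ a₀` apart
(`one_le_dist_of_mem_fccKissingPattern`, `A` isometric), and `a₀ > 2 · a₀/100`, so the nearby-atom
map is injective from the twelve pattern images to the twelve atoms, hence bijective
(`Fintype.bijective_iff_injective_and_card`); its inverse is the required `EtaMatched (a₀/100)`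
bijection, with the linear isometry `A.toLinearIsometry`.  All `[folklore]`.
-/

noncomputable section

open scoped BigOperators ENNReal
open MeasureTheory

namespace Summit.AtomisticToContinuum.Crystallization.Theorems.PalmGoodLaw.GoodOfSmallFccDefect

open Literature.MathematicalPhysics.StatisticalMechanics Literature.Geometry.DiscreteGeometry
open Literature.Probability.Process
open Summit.AtomisticToContinuum.Crystallization.Theorems.PalmUnimodularRigidity.LayeredLawsSelectHcp
  (rootStar)

/-- An empty annulus `11/10 < ‖y‖ ≤ 5/4` (zero counting mass) contains no atom of `S`. [folklore] -/
theorem not_mem_annulus_of_count_eq_zero {S : Set (EuclideanSpace ℝ (Fin 3))}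
    (hann : (Measure.count : Measure (EuclideanSpace ℝ (Fin 3))).restrict S
      {y : EuclideanSpace ℝ (Fin 3) | 11 / 10 < ‖y‖ ∧ ‖y‖ ≤ 5 / 4} = 0)
    {y : EuclideanSpace ℝ (Fin 3)} (hy : y ∈ S) (h₁ : 11 / 10 < ‖y‖) (h₂ : ‖y‖ ≤ 5 / 4) : False := by
  have hne : (Measure.count : Measure (EuclideanSpace ℝ (Fin 3))).restrict S {y} ≠ 0 :=
    (count_restrict_singleton_ne_zero_iff S y).2 hy
  have hle : (Measure.count : Measure (EuclideanSpace ℝ (Fin 3))).restrict S {y} ≤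
      (Measure.count : Measure (EuclideanSpace ℝ (Fin 3))).restrict S
        {y : EuclideanSpace ℝ (Fin 3) | 11 / 10 < ‖y‖ ∧ ‖y‖ ≤ 5 / 4} :=
    measure_mono (Set.singleton_subset_iff.2 ⟨h₁, h₂⟩)
  rw [hann] at hle
  exact hne (le_antisymm hle bot_le)

/-- Distinct points of the image `A (a₀ • fccKissingPattern)` of the scaled cuboctahedron under a linear
isometry are at distance `≥ a₀` (`a₀ ≥ 0`). [folklore] -/
theorem le_dist_of_mem_image {a₀ : ℝ} (ha : 0 ≤ a₀)
    (A : EuclideanSpace ℝ (Fin 3) ≃ₗᵢ[ℝ] EuclideanSpace ℝ (Fin 3)) {p q : EuclideanSpace ℝ (Fin 3)}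
    (hp : p ∈ fccKissingPattern) (hq : q ∈ fccKissingPattern) (hpq : A (a₀ • p) ≠ A (a₀ • q)) :
    a₀ ≤ dist (A (a₀ • p)) (A (a₀ • q)) := by
  have hpq' : p ≠ q := fun h => hpq (by rw [h])
  rw [LinearIsometryEquiv.dist_map, dist_smul₀, Real.norm_of_nonneg ha]
  simpa using mul_le_mul_of_nonneg_left (one_le_dist_of_mem_fccKissingPattern hp hq hpq') ha

/-- **stub_goodOfSmallFccDefect** (G_fcc of line `palm-good-law`): SMALL fcc-STAR DEFECT ⇒ `1 %`-GOOD
ROOT SHELL.  For `a₀ ∈ [189/200, 199/200]`, a `SetGood` root `0 ∈ S` with empty annulus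
`11/10 < ‖y‖ ≤ 5/4` whose root star has congruence defect `< 1/20000` against the regular cuboctahedron
`a₀ • fccKissingPattern` has, at the scale `a = a₀`, a closed punctured `5a/4`-shell which is
`ShellCloseTo (a/100)` the scaled fcc pattern: the twelve neighbours (`stub_twelveNeighbours`) are the
root star (empty annulus), each rotated pattern point has a neighbour within `√(1/20000) < a₀/100`
(`Metric.infDist_lt_iff`), and the nearby-atom map is injective (pattern images are `≥ a₀` apart)
between two twelve-element sets, hence a bijection. [folklore] -/
theorem stub_goodOfSmallFccDefect :
    ∀ a₀ : ℝ, 189 / 200 ≤ a₀ → a₀ ≤ 199 / 200 →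
      ∀ S : Set (EuclideanSpace ℝ (Fin 3)), (0 : EuclideanSpace ℝ (Fin 3)) ∈ S → SetGood S 0 →
        (Measure.count : Measure (EuclideanSpace ℝ (Fin 3))).restrict S {y : EuclideanSpace ℝ (Fin 3) | 11 / 10 < ‖y‖ ∧ ‖y‖ ≤ 5 / 4} = 0 →
        (⨅ A : EuclideanSpace ℝ (Fin 3) ≃ₗᵢ[ℝ] EuclideanSpace ℝ (Fin 3),
            ∑ p ∈ fccKissingPattern,
              Metric.infDist (A (a₀ • p))
                (Summit.AtomisticToContinuum.Crystallization.Theorems.PalmUnimodularRigidity.LayeredLawsSelectHcp.rootStar ((Measure.count : Measure (EuclideanSpace ℝ (Fin 3))).restrict S)) ^ 2) < 1 / 20000 →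
        ∃ a : ℝ, 9 / 10 ≤ a ∧ a ≤ 1 ∧ ∃ T : Finset (EuclideanSpace ℝ (Fin 3)),
          (↑T : Set (EuclideanSpace ℝ (Fin 3))) =
            {y : EuclideanSpace ℝ (Fin 3) | (Measure.count : Measure (EuclideanSpace ℝ (Fin 3))).restrict S {y} ≠ 0 ∧ y ≠ 0 ∧ ‖y‖ ≤ 5 / 4 * a} ∧
          ShellCloseTo (a / 100) T (Finset.image (fun v : EuclideanSpace ℝ (Fin 3) => a • v) fccKissingPattern) := by
  intro a₀ ha₁ ha₂ S _h0S hgood hann hdef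
  -- (1) the empty annulus
  have hann' : ∀ y ∈ S, 11 / 10 < ‖y‖ → ‖y‖ ≤ 5 / 4 → False :=
    fun y hy h₁ h₂ => not_mem_annulus_of_count_eq_zero hann hy h₁ h₂
  -- (2) the twelve neighbours, as a finite set
  set B : Set (EuclideanSpace ℝ (Fin 3)) :=
    {y : EuclideanSpace ℝ (Fin 3) | 0 < ‖y‖ ∧ ‖y‖ < 6 / 5} with hB_def
  have hmeas : MeasurableSet B :=
    (measurableSet_lt measurable_const measurable_norm).inter
      (measurableSet_lt measurable_norm measurable_const)
  have h12 : (Measure.count : Measure (EuclideanSpace ℝ (Fin 3))) (B ∩ S) = 12 := by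
    rw [← Measure.restrict_apply hmeas]
    exact TwelveNeighbours.stub_twelveNeighbours S hgood
  have hfin : (B ∩ S).Finite := by
    refine Measure.count_apply_lt_top.1 ?_
    rw [h12]
    exact ENNReal.ofNat_lt_top
  have hcard : hfin.toFinset.card = 12 := by
    rw [Measure.count_apply_finite _ hfin] at h12
    exact_mod_cast h12
  set T : Finset (EuclideanSpace ℝ (Fin 3)) := hfin.toFinset with hT_def
  have hTcoe : (↑T : Set (EuclideanSpace ℝ (Fin 3))) = B ∩ S := hfin.coe_toFinset
  have hmemT : ∀ y : EuclideanSpace ℝ (Fin 3), y ∈ T ↔ y ∈ S ∧ 0 < ‖y‖ ∧ ‖y‖ ≤ 11 / 10 := by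
    intro y
    rw [← Finset.mem_coe, hTcoe, hB_def]
    simp only [Set.mem_inter_iff, Set.mem_setOf_eq]
    constructor
    · rintro ⟨⟨h0, h65⟩, hyS⟩
      refine ⟨hyS, h0, ?_⟩
      by_contra h
      exact hann' y hyS (lt_of_not_ge h) (by linarith)
    · rintro ⟨hyS, h0, h11⟩
      exact ⟨⟨h0, by linarith⟩, hyS⟩
  -- the root star is `T`
  have hroot :
      rootStar ((Measure.count : Measure (EuclideanSpace ℝ (Fin 3))).restrict S) = ↑T := by
    ext y
    rw [Finset.mem_coe, hmemT y, ← count_restrict_singleton_ne_zero_iff S y]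
    rfl
  have hTne : (↑T : Set (EuclideanSpace ℝ (Fin 3))).Nonempty :=
    Finset.coe_nonempty.2 (Finset.card_pos.1 (by rw [hcard]; norm_num))
  -- (3) an almost optimal isometry
  obtain ⟨A, hA⟩ := exists_lt_of_ciInf_lt hdef
  rw [hroot] at hA
  have ha0 : 0 ≤ a₀ := by linarith
  have hnear : ∀ p ∈ fccKissingPattern, ∃ y ∈ T, dist (A (a₀ • p)) y < a₀ / 100 := by
    intro p hp
    have hterm : Metric.infDist (A (a₀ • p)) (↑T : Set (EuclideanSpace ℝ (Fin 3))) ^ 2 < 1 / 20000 :=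
      lt_of_le_of_lt
        (Finset.single_le_sum
          (f := fun p => Metric.infDist (A (a₀ • p)) (↑T : Set (EuclideanSpace ℝ (Fin 3))) ^ 2)
          (fun q _ => sq_nonneg _) hp) hA
    have hsq : Metric.infDist (A (a₀ • p)) (↑T : Set (EuclideanSpace ℝ (Fin 3))) ^ 2 <
        (a₀ / 100) ^ 2 :=
      hterm.trans_le (by nlinarith)
    have hlt : Metric.infDist (A (a₀ • p)) (↑T : Set (EuclideanSpace ℝ (Fin 3))) < a₀ / 100 :=
      lt_of_pow_lt_pow_left₀ 2 (by positivity) hsq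
    obtain ⟨y, hy, hd⟩ := (Metric.infDist_lt_iff hTne).1 hlt
    exact ⟨y, Finset.mem_coe.1 hy, hd⟩
  -- (4) the conclusion at scale `a₀`
  refine ⟨a₀, by linarith, by linarith, T, ?_, ?_⟩
  · ext y
    rw [Finset.mem_coe, hmemT y, Set.mem_setOf_eq, count_restrict_singleton_ne_zero_iff S y,
      ← norm_pos_iff]
    constructor
    · rintro ⟨hyS, h0, h11⟩
      exact ⟨hyS, h0, by linarith⟩
    · rintro ⟨hyS, h0, h54⟩
      refine ⟨hyS, h0, ?_⟩
      by_contra h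
      exact hann' y hyS (lt_of_not_ge h) (by linarith)
  · refine ⟨A.toLinearIsometry, ?_⟩
    set P' : Finset (EuclideanSpace ℝ (Fin 3)) :=
      (Finset.image (fun v : EuclideanSpace ℝ (Fin 3) => a₀ • v) fccKissingPattern).image
        A.toLinearIsometry with hP'_def
    have hmemP' : ∀ q : EuclideanSpace ℝ (Fin 3), q ∈ P' ↔ ∃ p ∈ fccKissingPattern, A (a₀ • p) = q := by
      intro q
      simp only [hP'_def, Finset.mem_image, LinearIsometryEquiv.coe_toLinearIsometry,
        exists_exists_and_eq_and]
    have hnear' : ∀ q ∈ P', ∃ y ∈ T, dist q y < a₀ / 100 := by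
      intro q hq
      obtain ⟨p, hp, rfl⟩ := (hmemP' q).1 hq
      exact hnear p hp
    choose g hgT hgd using hnear'
    -- pattern images are `≥ a₀` apart
    have hsep : ∀ q ∈ P', ∀ q' ∈ P', q ≠ q' → a₀ ≤ dist q q' := by
      intro q hq q' hq' hqq'
      obtain ⟨p, hp, rfl⟩ := (hmemP' q).1 hq
      obtain ⟨p', hp', rfl⟩ := (hmemP' q').1 hq'
      exact le_dist_of_mem_image ha0 A hp hp' hqq'
    -- the nearby-atom map and its injectivity (`a₀/100 + a₀/100 < a₀`)
    let G : ↥P' → ↥T := fun q => ⟨g q q.2, hgT q q.2⟩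
    have hGinj : Function.Injective G := by
      rintro ⟨q, hq⟩ ⟨q', hq'⟩ h
      have hgg : g q hq = g q' hq' := congrArg Subtype.val h
      by_contra hne
      have hne' : q ≠ q' := fun h' => hne (Subtype.ext h')
      have h1 := hgd q hq
      have h2 := hgd q' hq'
      rw [hgg] at h1
      have htri := dist_triangle_right q q' (g q' hq')
      have := hsep q hq q' hq' hne'
      linarith
    have hP'card : P'.card = 12 := by
      rw [hP'_def, Finset.card_image_of_injective _ A.toLinearIsometry.injective,
        Finset.card_image_of_injective _
          (smul_right_injective (EuclideanSpace ℝ (Fin 3)) (by linarith : a₀ ≠ 0)),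
        card_fccKissingPattern]
    have hGbij : Function.Bijective G :=
      (Fintype.bijective_iff_injective_and_card G).2 ⟨hGinj, by simp [hP'card, hcard]⟩
    -- the inverse bijection is the matching
    refine ⟨(Equiv.ofBijective G hGbij).symm, fun t => ?_⟩
    have hGt : G ((Equiv.ofBijective G hGbij).symm t) = t :=
      Equiv.ofBijective_apply_symm_apply G hGbij t
    have hval : (t : EuclideanSpace ℝ (Fin 3)) = g _ ((Equiv.ofBijective G hGbij).symm t).2 := by
      conv_lhs => rw [← hGt]
    rw [hval, dist_comm]
    exact (hgd _ _).le

end Summit.AtomisticToContinuum.Crystallization.Theorems.PalmGoodLaw.GoodOfSmallFccDefect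

end
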